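import Mathlib
import Literature.Barriers.ValiantsHypothesis.AlgebraicNaturalProofs
import Literature.Computability.AlgebraicComplexity.ArithCircuitProofs
import Summits.ValiantsHypothesis.ValiantsHypothesis.Theorems.BarrierLeverDefinableEquationsFullRankMethodWall
import Summits.ValiantsHypothesis.ValiantsHypothesis.Theorems.BarrierLeverDefinableEquationsFullRankMethodWallTwoPrelims

/-!
# Route BarrierLever — crux `DefinableEquations` (stmt-8745) / item `SingleSizeEquations`
# (stmt-8749): the FULL-RANK (min-partition-rank) METHOD WALL AT THE OPEN RUNG `b = 2`, part 2 —
# a product of `n` generic LINEAR FORMS in `2n` variables is of full rank (val-np-p5 g14)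

g9 made Raz's full-rank method an FSV-natural proof in the crux's regime
(`…FullRankMethod.lean`: a level-5 distinguisher `E_n` vanishing at `coeff(g)` for every
`g ∈ ℂ[x_1..x_{2n}]` that is NOT of full rank; reach: syntactically multilinear circuits of size
`< c·n²/log² n` (Alon–Kumar–Volk), multilinear formulas (Raz)), and g10 put the WALL of the method
against GENERAL circuits at cubic size (`…FullRankMethodWall.lean`: the Raz–Yehudayoff polynomial
with its auxiliary variables specialised, `6(n³+1) ≤ (2n)³` gates, so `b ≥ 3`).  This file moves the
wall to the crux's OPEN rung `b = 2`, with a one-line witness: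

**Theorem (`exists_isFullRank_piSigma`, `exists_isFullRank_smallCircuits_two`).**  For every `n`
there is a coefficient table `a ∈ ℂ^{n × 2n}` such that the product of linear forms
    `g_a = ∏_{k<n} ( ∑_{i<2n} a_{k,i} x_i )`
— a homogeneous depth-two `ΠΣ` circuit, degree `n`, fan-in-two complexity `≤ n(4n-1) + n = (2n)²`
— IS of full rank (`IsFullRank n g_a`: for EVERY balanced partition `Y ⊔ Z` of the `2n` variables
the `2^n × 2^n` matrix of multilinear coefficients `(coeff_{p·q} g_a)_{p ⊆ Y, q ⊆ Z}` is
nonsingular).  Hence `g_a ∈ SmallCircuits ℂ (2n) b` for every `b ≥ 2`, `n ≥ 1`, and (§5) no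
polynomial in the coefficient variables that is nonzero at every full-rank polynomial — the
soundness property of a full-rank certificate, g9's `E_n` included — vanishes on
`SmallCircuits ℂ (2n) b`, `b ≥ 2` (`no_fullRankCertificate_smallCircuits_two`,
`not_isNaturalProof_of_zeroSet_notFullRank_two`, `not_smallCircuits_subset_notFullRank_two`).

**Proof** (§0–§2 in part 1, `…FullRankMethodWallTwoPrelims.lean`).  Fix a partition `A`.  At the MATCHING POINT `a_{k,i} = [x_i ∈ {y_k, z_k}]` the
product becomes the matched product `P_A = ∏_k (y_k + z_k)` (§1), whose coefficient matrix is the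
permutation matrix `p ↦ {z_k : y_k ∉ p}` — formally: `M_{y+z} = (0 1; 1 0)` (`fullRk_X_add_X`, §0)
and the tree's Kronecker lemma `RazYehudayoff.FullRk.mul` along the factors
(`fullRk_matchedProd`) — so `det M_{P_A^A} ≠ 0` (`det_cM_matchedProd_ne_zero`, via the tree's
`injective_mulVec_cM`).  Over `ℂ[a]` the cut determinant of the GENERIC product therefore
specialises to a nonzero number, so it is a nonzero polynomial in `a` (§2,
`det_cM_generic_ne_zero`, `det_cM_map_rename`); the product over the finitely many `A` is nonzero,
so ONE complex table `a` makes every cut determinant nonzero (§3, `exists_good_table`,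
`MvPolynomial.funext`) — exactly g10's specialisation scheme, with `∏_k ℓ_k` in place of `f_{1,2n}`.
§4 counts gates (`complexity_linForm_le`: `2N-1` for a linear form in `N` variables, by the exact
iterated-subadditivity count `complexity_finset_sum_le_pred`; `complexity_finset_prod_le`) and
degree.

**Honest scope / chart line.**  The measure reads MULTILINEAR coefficients only, and the class
`SmallCircuits` (FSV Cor. 5: all polynomials of degree `≤ N` and small complexity) contains
non-multilinear polynomials whose multilinear projection is wild: `mult(∏_k ℓ_k) =
∑_S per(a[·,S]) x^S` is a permanental polynomial.  So: full-rank method — natural proofs against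
syntactically multilinear circuits `< c n²/log² n` and multilinear formulas (g9, unchanged; the
method keeps its teeth against MULTILINEAR models, where Raz–Yehudayoff's `n³` remains the upper
end) — WALL against the crux's class at `(2n)²`, i.e. `b = 2` (this file; was `b = 3`).  A
rearrangeable-network version of the same argument would give `O(N log N)` gates (not formalised
here).  What this is NOT: nothing on other methods, on the crux (`b = 2` OPEN, Chatterjee–Tengse
arXiv:2309.07612 §1.3 dir. 2) or on `VP ≠ VNP`.  No `Prop` definitions, no named facts, standard
axioms.  Refs: Raz–Yehudayoff, Comput. Complexity 17 (2008) §4.2.2, Thm. 4.2/4.4; Alon–Kumar–Volk,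
Combinatorica 40 (2020) §4; Forbes–Shpilka–Volk 2018 Def. 1/3, Cor. 5; Bürgisser 2000 §2.1.
-/

-- `Summit.ValiantsHypothesis.ValiantsHypothesis.…` repeats a component by the D-0017 layout
-- (single-conjunct summit), which the `dupNamespace` linter flags; the name is mandated.
set_option linter.dupNamespace false

noncomputable section

namespace Summit.ValiantsHypothesis.ValiantsHypothesis.Theorems.BarrierLeverDefinableEquations

open MvPolynomial
open Literature.Computability.AlgebraicComplexity hiding IsSyntacticallyMultilinear smCircuitSize
open Literature.Barriers.ValiantsHypothesis
open Literature.Barriers.ValiantsHypothesis.RazYehudayoff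
open scoped BigOperators

namespace FullRankMethodWallTwo

/-! ## §3 One complex coefficient table good for all partitions -/

section Specialise

variable (n : ℕ)

/-- There is a complex coefficient table at which all cut determinants are nonzero (a nonzero
complex polynomial has a non-root, `MvPolynomial.funext`). [folklore] -/
theorem exists_good_table :
    ∃ a : Par n → ℂ, ∀ A : Fin (2 * n) ≃ Fin n ⊕ Fin n,
      eval a (cM (rename A (genericLinProd n))).det ≠ 0 := by
  classical
  set Q := ∏ A : Fin (2 * n) ≃ Fin n ⊕ Fin n, (cM (rename A (genericLinProd n))).det with hQ
  have hQ0 : Q ≠ 0 := prod_det_cM_generic_ne_zero n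
  obtain ⟨a, ha⟩ : ∃ a : Par n → ℂ, eval a Q ≠ 0 := by
    by_contra h
    simp only [not_exists, not_not] at h
    exact hQ0 (MvPolynomial.funext fun a => by rw [h a, map_zero])
  refine ⟨a, fun A => ?_⟩
  rw [hQ, map_prod] at ha
  exact Finset.prod_ne_zero_iff.1 ha A (Finset.mem_univ A)

/-- **A product of `n` linear forms in `2n` variables of full rank over `ℂ`**: for a good table
`a`, every one of the partial-derivative matrices of `∏_k ∑_i a_{k,i} x_i` is nonsingular.
[cite: RazYehudayoff2008, §4.2.2 ("full rank")] -/
theorem exists_isFullRank_linProd :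
    ∃ a : Fin n → Fin (2 * n) → ℂ, IsFullRank n (linProd n a) := by
  classical
  obtain ⟨a, ha⟩ := exists_good_table n
  refine ⟨fun k i => a (k, i), fun A => ?_⟩
  have hmap : linProd n (fun k i => a (k, i)) =
      MvPolynomial.map (eval a) (genericLinProd n) := by
    rw [genericLinProd, map_linProd]
    simp only [eval_X]
  have hdet : (pdMatrix (rename A (linProd n fun k i => a (k, i)))).det ≠ 0 := by
    rw [pdMatrix_eq_cM, hmap, det_cM_map_rename]
    exact ha A
  rw [FullRankMethodWall.rank_eq_card_of_det_ne_zero _ hdet, Fintype.card_finset, Fintype.card_fin]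

end Specialise

/-! ## §4 Degree and complexity of a product of linear forms -/

section Size

variable {σ : Type*}

/-- Iterated subadditivity with the exact gate count: `L(f₀ + ∑_{i ∈ s} fᵢ) ≤ L(f₀) + ∑ L(fᵢ) + #s`
(one addition gate per summand ADDED to `f₀`). [cite: Burgisser2000, §2.1] -/
theorem complexity_add_finset_sum_le {ι : Type*} (f₀ : MvPolynomial σ ℂ) (s : Finset ι)
    (f : ι → MvPolynomial σ ℂ) :
    complexity (f₀ + ∑ i ∈ s, f i) ≤ complexity f₀ + ∑ i ∈ s, complexity (f i) + s.card := by
  classical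
  induction s using Finset.induction_on with
  | empty => simp
  | insert b s hb ih =>
    rw [Finset.sum_insert hb, Finset.sum_insert hb, Finset.card_insert_of_notMem hb, add_left_comm]
    calc complexity (f b + (f₀ + ∑ i ∈ s, f i))
        ≤ complexity (f b) + complexity (f₀ + ∑ i ∈ s, f i) + 1 := complexity_add_le_holds _ _
      _ ≤ complexity (f b) + (complexity f₀ + ∑ i ∈ s, complexity (f i) + s.card) + 1 := by
          gcongr
      _ = _ := by ring

/-- `L(∑_{i ∈ s} fᵢ) ≤ ∑ L(fᵢ) + (#s - 1)`: `#s - 1` addition gates suffice. [cite: Burgisser2000, §2.1] -/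
theorem complexity_finset_sum_le_pred {ι : Type*} (s : Finset ι) (f : ι → MvPolynomial σ ℂ) :
    complexity (∑ i ∈ s, f i) ≤ ∑ i ∈ s, complexity (f i) + (s.card - 1) := by
  classical
  rcases s.eq_empty_or_nonempty with rfl | ⟨b, hb⟩
  · simpa using complexity_C_holds (σ := σ) (0 : ℂ)
  · rw [← Finset.insert_erase hb, Finset.sum_insert (Finset.notMem_erase b s),
      Finset.sum_insert (Finset.notMem_erase b s), Finset.card_insert_of_notMem (Finset.notMem_erase b s)]
    have h := complexity_add_finset_sum_le (f b) (s.erase b) f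
    omega

/-- A linear form `∑_{i < N} a_i x_i` costs `≤ 2N - 1` gates (`N` scalar multiplications,
`N - 1` additions). [cite: Burgisser2000, §2.1] -/
theorem complexity_linForm_le {N : ℕ} (a : Fin N → ℂ) :
    complexity (∑ i : Fin N, C (a i) * X i : MvPolynomial (Fin N) ℂ) ≤ 2 * N - 1 := by
  have h1 : ∑ i : Fin N, complexity (C (a i) * X i : MvPolynomial (Fin N) ℂ) ≤ ∑ _i : Fin N, 1 := by
    refine Finset.sum_le_sum fun i _ => ?_
    calc complexity (C (a i) * X i : MvPolynomial (Fin N) ℂ)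
        ≤ complexity (C (a i) : MvPolynomial (Fin N) ℂ) +
            complexity (X i : MvPolynomial (Fin N) ℂ) + 1 := complexity_mul_le_holds _ _
      _ = 1 := by rw [complexity_C_holds, complexity_X_holds]
  have h2 := complexity_finset_sum_le_pred (Finset.univ : Finset (Fin N))
    (fun i => C (a i) * (X i : MvPolynomial (Fin N) ℂ))
  simp only [Finset.sum_const, Finset.card_univ, Fintype.card_fin, smul_eq_mul, mul_one] at h1 h2
  omega

variable (n : ℕ)

/-- **Complexity**: `L(∏_{k<n} ∑_{i<2n} a_{k,i} x_i) ≤ n (4n - 1) + n ≤ 4n² = (2n)²`.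
[cite: Burgisser2000, §2.1] -/
theorem complexity_linProd_le (a : Fin n → Fin (2 * n) → ℂ) :
    complexity (linProd n a) ≤ (2 * n) ^ 2 := by
  unfold linProd
  refine (complexity_finset_prod_le _ _).trans ?_
  rw [Finset.card_univ, Fintype.card_fin]
  calc ∑ k : Fin n, complexity (∑ i : Fin (2 * n), C (a k i) * X i : MvPolynomial (Fin (2 * n)) ℂ) + n
      ≤ ∑ _k : Fin n, (2 * (2 * n) - 1) + n :=
        Nat.add_le_add_right (Finset.sum_le_sum fun k _ => complexity_linForm_le (a k)) n
    _ ≤ (2 * n) ^ 2 := by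
        rw [Finset.sum_const, Finset.card_univ, Fintype.card_fin, smul_eq_mul]
        rcases Nat.eq_zero_or_pos n with rfl | hn
        · simp
        · have : n * (2 * (2 * n) - 1) + n = 4 * n * n := by
            have h4 : 1 ≤ 2 * (2 * n) := by omega
            zify [h4]
            ring
          rw [this]
          nlinarith

/-- **Degree**: `deg (∏_{k<n} ∑_i a_{k,i} x_i) ≤ n`. [folklore] -/
theorem totalDegree_linProd_le {R : Type*} [CommSemiring R] (a : Fin n → Fin (2 * n) → R) :
    (linProd n a).totalDegree ≤ n := by
  unfold linProd
  refine (totalDegree_finsetProd _ _).trans ?_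
  calc ∑ k : Fin n, (∑ i : Fin (2 * n), C (a k i) * X i : MvPolynomial (Fin (2 * n)) R).totalDegree
      ≤ ∑ _k : Fin n, 1 := by
        refine Finset.sum_le_sum fun k _ => ?_
        refine (totalDegree_finsetSum _ _).trans (Finset.sup_le fun i _ => ?_)
        refine (totalDegree_mul _ _).trans ?_
        rw [totalDegree_C, zero_add]
        rcases subsingleton_or_nontrivial R with hR | hR
        · simp [Subsingleton.elim (X i : MvPolynomial (Fin (2 * n)) R) 0]
        · rw [totalDegree_X]
    _ = n := by simp

end Size

/-! ## §5 The wall at `b = 2` -/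

section Wall

/-- **A full-rank polynomial INSIDE `SmallCircuits ℂ (2n) 2`**: for every `n ≥ 1` some product of
`n` linear forms in `2n` variables — degree `n ≤ 2n`, complexity `≤ (2n)²` — is of full rank
(all `2^n × 2^n` partial-derivative matrices nonsingular). The wall of g10
(`FullRankMethodWall.exists_isFullRank_smallCircuits`: `b ≥ 3`, Raz–Yehudayoff specialised,
`6(n³+1)` gates) thus moves to the open rung `b = 2`. [cite: ForbesShpilkaVolk2018, Cor. 5]
[cite: RazYehudayoff2008, §4.2.2] -/
theorem exists_isFullRank_smallCircuits_two {n b : ℕ} (hn : 1 ≤ n) (hb : 2 ≤ b) :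
    ∃ g ∈ SmallCircuits ℂ (2 * n) b, IsFullRank n g := by
  obtain ⟨a, ha⟩ := exists_isFullRank_linProd n
  refine ⟨linProd n a, ⟨(totalDegree_linProd_le n a).trans (by omega), ?_⟩, ha⟩
  exact (complexity_linProd_le n a).trans (Nat.pow_le_pow_right (by omega) hb)

/-- The same with the witness's shape on display: a product of `n` linear forms (a homogeneous
depth-two `ΠΣ` circuit of degree `n`) of complexity `≤ (2n)²` of full rank. [cite: RazYehudayoff2008, §4.2.2] -/
theorem exists_isFullRank_piSigma (n : ℕ) :
    ∃ a : Fin n → Fin (2 * n) → ℂ, complexity (linProd n a) ≤ (2 * n) ^ 2 ∧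
      (linProd n a).totalDegree ≤ n ∧ IsFullRank n (linProd n a) := by
  obtain ⟨a, ha⟩ := exists_isFullRank_linProd n
  exact ⟨a, complexity_linProd_le n a, totalDegree_linProd_le n a, ha⟩

/-- **The wall, set form, at `b = 2`**: the non-full-rank locus — the zero set of g9's full-rank
equation `E_n` — does NOT contain `SmallCircuits ℂ (2n) b` for any `b ≥ 2`, `n ≥ 1`.
[cite: RazYehudayoff2008, Thm. 4.4] [cite: ForbesShpilkaVolk2018, Def. 1] -/
theorem not_smallCircuits_subset_notFullRank_two {n b : ℕ} (hn : 1 ≤ n) (hb : 2 ≤ b) :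
    ¬ SmallCircuits ℂ (2 * n) b ⊆ {g : MvPolynomial (Fin (2 * n)) ℂ | ¬ IsFullRank n g} := by
  intro h
  obtain ⟨g, hg, hfull⟩ := exists_isFullRank_smallCircuits_two hn hb
  exact h hg hfull

/-- **The wall, certificate form, at `b = 2`**: no polynomial `D` in the `N = binom(4n,2n)`
coefficient variables (any size, any degree, Boolean sums included) that is NONZERO at every
full-rank polynomial of degree `≤ 2n` vanishes on `SmallCircuits ℂ (2n) b`, `b ≥ 2`, `n ≥ 1`.
[cite: ForbesShpilkaVolk2018, Def. 1] -/
theorem no_fullRankCertificate_smallCircuits_two {n b : ℕ} (hn : 1 ≤ n) (hb : 2 ≤ b) :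
    ¬ ∃ D : MvPolynomial (degLEMonomials (2 * n)) ℂ,
      (∀ g : MvPolynomial (Fin (2 * n)) ℂ, g.totalDegree ≤ 2 * n → IsFullRank n g →
        eval (coeffVector (degLEMonomials (2 * n)) g) D ≠ 0) ∧
      ∀ f ∈ SmallCircuits ℂ (2 * n) b, eval (coeffVector (degLEMonomials (2 * n)) f) D = 0 := by
  rintro ⟨D, hsound, hvan⟩
  obtain ⟨g, hg, hfull⟩ := exists_isFullRank_smallCircuits_two hn hb
  exact hsound g hg.1 hfull (hvan g hg)

/-- In FSV's vocabulary, at `b = 2`: a `D` whose zero set on degree-`≤ 2n` coefficient vectors is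
exactly the non-full-rank locus (as g9's `E_n`) is not an `IsNaturalProof` against
`SmallCircuits ℂ (2n) b`, `b ≥ 2`, `n ≥ 1`, in ANY distinguisher class `𝒟` — the min-partition-rank
method gives no natural proof against the crux's class at its open rung.
[cite: ForbesShpilkaVolk2018, Def. 1] -/
theorem not_isNaturalProof_of_zeroSet_notFullRank_two {n b : ℕ} (hn : 1 ≤ n) (hb : 2 ≤ b)
    (𝒟 : Set (MvPolynomial (degLEMonomials (2 * n)) ℂ)) (D : MvPolynomial (degLEMonomials (2 * n)) ℂ)
    (hD : ∀ g : MvPolynomial (Fin (2 * n)) ℂ, g.totalDegree ≤ 2 * n →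
      (eval (coeffVector (degLEMonomials (2 * n)) g) D = 0 ↔ ¬ IsFullRank n g)) :
    ¬ IsNaturalProof (degLEMonomials (2 * n)) (SmallCircuits ℂ (2 * n) b) 𝒟 D := by
  rintro ⟨-, -, hvan⟩
  obtain ⟨g, hg, hfull⟩ := exists_isFullRank_smallCircuits_two hn hb
  exact (hD g hg.1).1 (hvan g hg) hfull

end Wall

end FullRankMethodWallTwo

end Summit.ValiantsHypothesis.ValiantsHypothesis.Theorems.BarrierLeverDefinableEquations
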